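import Summits.QuantumFields.YangMills.Theorems.AllWindowsColdBoxBoxHighLineQuadFormFluct
import Summits.QuantumFields.YangMills.Theorems.AllWindowsColdBoxBoxHighLineEdgeChartWick

/-!
# Transfer of the chart Gaussian `gaussAvg β H` to the reference Gaussian process `P_β` (every functional, no integrability needed)

LEAD seat `ym-line-sfw-p2` (g78), cell ym-idea-1; U5 prep, helper-grade.  The connected-diagram engines ✓`WickTwoPairs` /
✓`WickTwoPairsSides` (and the tree's ✓`GaussianWick.*`) speak about a centred Gaussian PROCESS on a probability space; the U5 sizes are
stated for the chart average `gaussAvg β H F = (∫ F·e^{−β·boxQuadForm})/(∫ e^{−β·boxQuadForm})`.  This file packages the bridge once: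

★ `gaussAvg_eq_integral_pi` — for `H`, `β > 0` there is an invertible `M` (a square root of the reindexed precision `(hodgeQ H ⊗ 1₃)∘e⁻¹`,
`e = Fintype.equivFin`) such that for EVERY `F : (LandauFree H → ℝ³) → ℝ`
  `gaussAvg β H F = ∫ F(Ψ_M w) dP_β(w)`,  `Ψ_M w = ♭⁻¹((M⁻¹w) ∘ e)`,  `P_β = ⊗ N(0,(2β)⁻¹)`,
every flat linear form is a LEG of g77's legs process, `t ⬝ᵥ ♭(Ψ_M w) = (t∘e⁻¹) ⬝ᵥ (M⁻¹ w)` (✓`isGaussianProcess_legs`, centred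
✓`integral_leg_eq_zero`), and the two-point function of two such legs is the chart propagator
  `∫ ((t∘e⁻¹)⬝M⁻¹w)((t'∘e⁻¹)⬝M⁻¹w) dP_β = (2β)⁻¹ · t ⬝ᵥ (hodgeQ H ⊗ 1₃)⁻¹ t'`.
Corollaries: the coordinate `(Ψ_M w) e c` and the linearised curvature `linCurv H p (Ψ_M w) c` as legs, and their propagators
(`(2β)⁻¹·[c=c']·G_H(e,e')`, ✓`EdgeChartWick.kronecker_one_inv_apply`).

Assembled from ✓`GaussianChartWick` (`integral_mul_exp_eq_integral_pi`, `integral_leg_mul_leg`, the `equivFin` reindexing) and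
✓`EdgeChartGaussian.integral_eq_flat`; no definitions; standard axioms.  HONEST LABEL: plumbing for the RECORDED lifts L2/L3 of the NEXT rung U5
(⟨stmt-QuantumFields-24336⟩, UNSTAFFED); ⟨24004⟩ ⟨24336⟩ and this seat's crux ⟨stmt-QuantumFields-22884⟩ remain OPEN; route AllWindowsColdBox is DRAFT;
no crux, rung or summit is proved; **the Yang–Mills mass gap is NOT proved by this file; no summit is proved by a line.**
-/

set_option autoImplicit false

noncomputable section

open MeasureTheory ProbabilityTheory Matrix Finset
open scoped Kronecker

namespace Summit.QuantumFields.YangMills.Theorems.AllWindowsColdBoxBoxHighLine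

namespace GaussianChartWick

open LaplaceSandwich (flatten flatten_apply)
open EdgeChartGaussian (integral_eq_flat)

/-- ★★ **TRANSFER OF `gaussAvg` TO `P_β`.**  For every `H` and `β > 0` there is an invertible `M` on `Fin |LandauFree H × Fin 3|` with
`MᵀM = (hodgeQ H ⊗ 1₃).submatrix e⁻¹ e⁻¹` (`e = Fintype.equivFin`) such that, with `Ψ w = ♭⁻¹(fun i => (M⁻¹ w)(e i))`:
(i) `gaussAvg β H F = ∫ F (Ψ w) dP_β(w)` for EVERY `F`; (ii) flat linear forms are legs: `t ⬝ᵥ ♭(Ψ w) = (t ∘ e⁻¹) ⬝ᵥ M⁻¹ w`;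
(iii) the two-point function of two such legs under `P_β` is `(2β)⁻¹ · t ⬝ᵥ (hodgeQ H ⊗ 1₃)⁻¹ t'`. -/
theorem gaussAvg_eq_integral_pi (H : ℕ) {β : ℝ} (hβ : 0 < β) :
    ∃ M : Matrix (Fin (Fintype.card (LandauFree H × Fin 3))) (Fin (Fintype.card (LandauFree H × Fin 3))) ℝ,
      M.det ≠ 0 ∧
      (∀ F : (LandauFree H → E3) → ℝ,
        gaussAvg β H F =
          ∫ w, F ((flatten (LandauFree H)).symm fun i => (M⁻¹ *ᵥ w) (Fintype.equivFin (LandauFree H × Fin 3) i))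
            ∂(Measure.pi fun _ : Fin (Fintype.card (LandauFree H × Fin 3)) => gaussianReal 0 (Real.toNNReal (2 * β)⁻¹))) ∧
      (∀ (t : LandauFree H × Fin 3 → ℝ) (w : Fin (Fintype.card (LandauFree H × Fin 3)) → ℝ),
        t ⬝ᵥ flatten (LandauFree H) ((flatten (LandauFree H)).symm fun i => (M⁻¹ *ᵥ w) (Fintype.equivFin (LandauFree H × Fin 3) i)) =
          (fun j => t ((Fintype.equivFin (LandauFree H × Fin 3)).symm j)) ⬝ᵥ (M⁻¹ *ᵥ w)) ∧
      (∀ t t' : LandauFree H × Fin 3 → ℝ,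
        ∫ w, ((fun j => t ((Fintype.equivFin (LandauFree H × Fin 3)).symm j)) ⬝ᵥ (M⁻¹ *ᵥ w)) *
              ((fun j => t' ((Fintype.equivFin (LandauFree H × Fin 3)).symm j)) ⬝ᵥ (M⁻¹ *ᵥ w))
            ∂(Measure.pi fun _ : Fin (Fintype.card (LandauFree H × Fin 3)) => gaussianReal 0 (Real.toNNReal (2 * β)⁻¹)) =
          (2 * β)⁻¹ * (t ⬝ᵥ ((hodgeQ H ⊗ₖ (1 : Matrix (Fin 3) (Fin 3) ℝ))⁻¹ *ᵥ t'))) := by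
  classical
  have hP : (hodgeQ H ⊗ₖ (1 : Matrix (Fin 3) (Fin 3) ℝ)).PosDef := GaussianChartWick.posDef_kronecker_one _ (hodgeQ_posDef H)
  have hP'pd : ((hodgeQ H ⊗ₖ (1 : Matrix (Fin 3) (Fin 3) ℝ)).submatrix (Fintype.equivFin (LandauFree H × Fin 3)).symm
      (Fintype.equivFin (LandauFree H × Fin 3)).symm).PosDef := posDef_submatrix_equivFin _ hP
  obtain ⟨M, hMP, hMdet⟩ := exists_transpose_mul_self_of_posDef _ hP'pd
  refine ⟨M, hMdet, fun F => ?_, fun t w => ?_, fun t t' => ?_⟩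
  · -- (i) the transfer of the average
    have hnum : ∀ G : (LandauFree H → E3) → ℝ, ∫ a, G a * gaussWeight β H a =
        Real.sqrt (Real.pi / β) ^ Fintype.card (LandauFree H × Fin 3) / |M.det| *
          ∫ w, G ((flatten (LandauFree H)).symm fun i => (M⁻¹ *ᵥ w) (Fintype.equivFin (LandauFree H × Fin 3) i))
            ∂(Measure.pi fun _ : Fin (Fintype.card (LandauFree H × Fin 3)) => gaussianReal 0 (Real.toNNReal (2 * β)⁻¹)) := by
      intro G
      -- flatten
      have h1 : ∫ a, G a * gaussWeight β H a =
          ∫ v : LandauFree H × Fin 3 → ℝ, G ((flatten (LandauFree H)).symm v) *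
            Real.exp (-(β * (v ⬝ᵥ ((hodgeQ H ⊗ₖ (1 : Matrix (Fin 3) (Fin 3) ℝ)) *ᵥ v)))) := by
        rw [← integral_eq_flat]
        refine integral_congr_ae (Filter.Eventually.of_forall fun a => ?_)
        simp only [gaussWeight, QuadFluct.boxQuadForm_eq_flat, MeasurableEquiv.symm_apply_apply]
      -- reindex
      have h2 : ∫ v : LandauFree H × Fin 3 → ℝ, G ((flatten (LandauFree H)).symm v) *
            Real.exp (-(β * (v ⬝ᵥ ((hodgeQ H ⊗ₖ (1 : Matrix (Fin 3) (Fin 3) ℝ)) *ᵥ v)))) =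
          ∫ w : Fin (Fintype.card (LandauFree H × Fin 3)) → ℝ,
            G ((flatten (LandauFree H)).symm fun i => w (Fintype.equivFin (LandauFree H × Fin 3) i)) *
            Real.exp (-(β * (M *ᵥ w ⬝ᵥ M *ᵥ w))) := by
        rw [← integral_comp_equivFin]
        refine integral_congr_ae (Filter.Eventually.of_forall fun w => ?_)
        simp only [quadForm_comp_equivFin, mulVec_dotProduct_mulVec_of_transpose_mul_self hMP]
      rw [h1, h2, integral_mul_exp_eq_integral_pi M hMdet hβ]
    have hden := hnum (fun _ => (1 : ℝ))
    simp only [one_mul] at hden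
    have hprob : IsProbabilityMeasure
        (Measure.pi fun _ : Fin (Fintype.card (LandauFree H × Fin 3)) => gaussianReal 0 (Real.toNNReal (2 * β)⁻¹)) :=
      inferInstance
    rw [integral_const, smul_eq_mul, mul_one, probReal_univ, mul_one] at hden
    have hZ : 0 < Real.sqrt (Real.pi / β) ^ Fintype.card (LandauFree H × Fin 3) / |M.det| :=
      div_pos (pow_pos (Real.sqrt_pos.mpr (div_pos Real.pi_pos hβ)) _) (abs_pos.mpr hMdet)
    unfold gaussAvg
    rw [hnum F, hden, mul_div_cancel_left₀ _ hZ.ne']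
  · -- (ii) flat linear forms are legs
    rw [MeasurableEquiv.apply_symm_apply, dotProduct_comp_equivFin]
  · -- (iii) the two-point function
    rw [integral_leg_mul_leg M hβ, vecMul_inv_dotProduct_vecMul_inv, hMP, inv_submatrix_equivFin,
      dotProduct_submatrix_equivFin_mulVec]

/-- The coordinate `a e c` is the flat linear form `Pi.single (e,c) 1`: `a e c = Pi.single (e, c) 1 ⬝ᵥ ♭a`. -/
theorem coord_eq_single_dotProduct_flatten {H : ℕ} (a : LandauFree H → E3) (e : LandauFree H) (c : Fin 3) :
    a e c = Pi.single (e, c) (1 : ℝ) ⬝ᵥ flatten (LandauFree H) a := by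
  rw [single_one_dotProduct, flatten_apply]

/-- The linearised curvature `ℓ_p^c(a) = landauCoeff H p ⬝ᵥ a^c` is the flat linear form `(e', c') ↦ [c' = c]·landauCoeff H p e'`. -/
theorem linCurv_eq_dotProduct_flatten (H : ℕ) (p : Literature.MathematicalPhysics.QuantumFieldTheory.Plaq 4) (a : LandauFree H → E3)
    (c : Fin 3) :
    linCurv H p a c = (fun q : LandauFree H × Fin 3 => if q.2 = c then landauCoeff H p q.1 else 0) ⬝ᵥ flatten (LandauFree H) a := by
  exact EdgeChartGaussian.leg_eq_flat (landauCoeff H p) a c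

/-- The chart propagator between two coordinates: `(2β)⁻¹ · e_{(e,c)} ⬝ (hodgeQ ⊗ 1)⁻¹ e_{(e',c')} = (2β)⁻¹ · [c = c'] · G_H(e,e')`. -/
theorem single_propagator_eq (H : ℕ) (β : ℝ) (e e' : LandauFree H) (c c' : Fin 3) :
    (2 * β)⁻¹ * (Pi.single (e, c) (1 : ℝ) ⬝ᵥ ((hodgeQ H ⊗ₖ (1 : Matrix (Fin 3) (Fin 3) ℝ))⁻¹ *ᵥ Pi.single (e', c') (1 : ℝ))) =
      (2 * β)⁻¹ * (if c = c' then (hodgeQ H)⁻¹ e e' else 0) := by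
  rw [EdgeChartGaussian.single_dotProduct_inv_mulVec_single (hodgeQ H) (hodgeQ_posDef H).det_pos.ne']

end GaussianChartWick

end Summit.QuantumFields.YangMills.Theorems.AllWindowsColdBoxBoxHighLine

end
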